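import Mathlib
import HarnessLib
import HarnessLib.Audit
import Summits.QuantumAdvantage.Statement
import Literature.Computability.Cryptography.ClassBQP
import Literature.Computability.Cryptography.OneWayFunctions
import Literature.Computability.Complexity.BoolEncodings
import Literature.Computability.MetaComplexity.HeuristicClasses
import Literature.NumberTheory.QuadraticFields.ReducedForms
import HarnessLib.Audit.Status.Attr

/-!
Route: RegulatorThird

DORMANT since 2026-08-26T13:37:50Z (reconciler: no traction for 7.1 d (last activity item-proof-filed at 2026-08-19T10:05:31Z); parked, not closed — `ledger route dormant route-QuantumAdvantage-RegulatorThird --off` to reactivate) — unstaffed, not closed; items shared with open routes are served there. `ledger route dormant <id> --off` reactivates.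

# Route RegulatorThird — one third of the regulator - the 3-division point of Shanks' infrastructure
is the Scholz-Kummer cubic field, a GRH-free total witness with the weakest hypothesis of the mirror
cluster

It suffices to show X = ThirdNotBPPR: the language THIRD is not in BPP, where THIRD := { <bin D, w>
: D > 1 non-square, w a prefix of code(A*, B*, n*) }, and (A*, B*, n*) is the LEAST triple (key
|A|+|B|+n, then lexicographic) such that the element (A + B sqrt s)/n of K = Q(sqrt s) (s =
square-free kernel of D) lies in eta K^{x3} U eta^{-1} K^{x3}, eta the fundamental unit - i.e. the
canonical small representative of the fundamental unit MODULO CUBES ("one third of the regulator":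
it is carried by the reduced principal ideal at Shanks distance R/3). The quantum half THIRD in BQP
is theorem-grade and GRH-free (cruxes OneThirdRep, OneThirdFP, ThirdMemBQPOfFP: Shor for the
square-free kernel and Hallgren's integer part of R are PROVED tree theorems; everything after them
is classical FP), so closes (OneThirdRep) (OneThirdFP) (ThirdMemBQPOfFP) (ThirdNotBPPR) :
QuantumAdvantage is the existential summit with witness THIRD. RECOMBINATION (lens recomb):
ArithStatLadder's banked mirror machinery (UnitCubeMemBQP / MirrorHeurTransfer / Scholz-Hecke files)
+ CentralFactorial's Pell-face pipeline (Hallgren2007_regulator_qsolvable_holds,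
JacobsonWilliams2008_unitResidue_mem_FP_holds) + LinnikCubicClassGroups' cubic-field Literature
(Delone-Faddeev, Bhargava-Varma 3-torsion parametrization) + Shor's banked factoring_mem_FBQP,
recombined around a NEW object: the 3-division point of the distance circle R/RZ.
Lean: `ThirdNotBPPR` (the set-builder language over `Literature.Computability.Complexity.boolPair`,
`Computability.encodeNat`, `IsSquare`, `Squarefree`, `NumberField.RingOfIntegers`, `Module.finrank`,
`List.IsPrefix`, not in `Literature.Computability.Complexity.BPP`; full term = item ThirdNotBPPR
below, rc 0 in Sketch.lean)

REPAIRED 2026-08-16 (rev 2): the original target ThirdNotBPP (stmt-QuantumAdvantage-15712) was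
refuted-MISSTATED by Theorems.RegulatorThirdThirdNotBPP_refuted (its inlined cube-class clause
admitted z = 0, so the least triple was always (0,0,1) and THIRD was a P language); every decl now
carries the clause `∃ z : K, z ≠ 0 ∧ ((A+Bα)/n = u z³ ∨ (A+Bα)/n = u⁻¹ z³)` and X is the successor
decl ThirdNotBPPR (the refuted decl stays in the negatives index); OneThirdFP, OneThirdRep,
ThirdMemBQPOfFP, ThirdMemBQP, ThirdCoreClassical were restated 1:1 with the same clause,
MirrorDominates and Assembly re-pointed, closes re-certified.

## Assembly
Pure logic against the existential statement QuantumAdvantage = BQPNotSubsetBPP = (exists L, L in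
BQP and L notin BPP): ThirdMemBQPOfFP applied to OneThirdRep and OneThirdFP gives THIRD in BQP, and
ThirdNotBPPR is THIRD notin BPP; the anonymous constructor closes. Deciding theorem (glue.lean, rc
0): `theorem closes (h1 : OneThirdRep) (h2 : OneThirdFP) (h3 : ThirdMemBQPOfFP) (h4 : ThirdNotBPPR)
: QuantumAdvantage := <_, h3 h1 h2, h4>` - every crux is a hypothesis and every hypothesis is used;
the Assembly item below records the same implication as a statement (provable now by the same term).

Rationale: WHY THIS LINE. MECHANISM. The reduced principal ideals of Q(sqrt s) sit on a circle of circumference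
R = log eta (Shanks' infrastructure; Jozsa2003 sec. 7-9, JacobsonWilliams2008 Ch. 7; tree:
RealQuadraticInfrastructureDistance, InfrastructureGiantStep). Its l-DIVISION POINTS carry
arithmetic: at R/2 sits the principal ambiguous ideal, i.e. a factorisation of the discriminant
(Gauss; Shanks' SQUFOF; Schoof1982), and which ambiguous ideal is principal is classical given the
factorisation (2-Sylow of the narrow class group, Lagarias1980) - the 2-division point IS factoring;
at R/3 sits the ideal b = (gamma) for which alpha = eta * conj(gamma)^3 has BOTH conjugates of size
<= s^{3/4}: a polynomial-size generator of the class of eta modulo cubes, whose cube root generates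
the complex cubic field Q(cbrt(eta) + cbrt(eta)^{-1}) = the Scholz-Kummer mirror field (Scholz1932,
Hecke Satz 118-119, Washington1997 Thm 10.10; tree: ScholzHeckeKummerDescent,
CubeClassesOfTrivialThreeTorsion, UnitsModCubes), of discriminant exactly -d on ArithStatLadder's
unit-cube locus. Quantum period finding over R reaches EVERY division point (Hallgren gives the
integer part of R with no GRH; the rest is giant steps and exact rounding), classical genus theory
reaches only l = 2: the 3-part of class groups has no genus theory, which is why the witness is
factoring-independent in the same sense as ArithStatLadder's IQ3. WHY X IS EASIER TO HOLD than the
summit: X is implied by EACH of (i) ArithStatLadder's average-case face AvgFaceBeyondPrior (support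
MirrorDominates, provable from the landed MirrorHeurTransfer: a BPP machine for THIRD decides the
cube class of eta at 3 by a finite 3-adic computation on (A*,B*,n*), hence agrees with IQ3 off the
Davenport-Heilbronn-rare set), (ii) worst-case SEARCH hardness of constructing the cubic field of
discriminant -d from d on the Scholz locus (informal support FindDominates: from (A*,B*,n*) the
field is x^3 -+ 3Nx - Tr, classical algebra), and it implies (iii) hardness of Pell/regulator
computation (crux OneThirdFP read contrapositively) - so X is the weakest hypothesis of the whole
mirror cluster (ArithStatLadder W/M, CentralFactorial, card regulator-digits-need-transcendence T3)
while its quantum half stays a theorem. Imported areas: computational algebraic number theory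
(infrastructure, compact representations: BuchmannThielWilliams1995, JacobsonWilliams2008 Ch. 12;
Kummer generation of class fields: Cohen2000 Ch. 5, Fieker2000, BuhlerStevenhagen2008 pp. 497-534),
reflection theorems (Scholz1932), quantum HSP over R (Hallgren2007, Jozsa2003; quantum class fields
in general: EisentragerHallgren2010). What no listed route does: none outputs the cubic FIELD / the
global cube class of the unit (ArithStatLadder uses one 3-adic digit of eta, CentralFactorial eta
mod p, LinnikCubicClassGroups class groups OF cubic fields), and none has a hypothesis provably
below both a decision and a search hypothesis of the cluster.

RANKED CRUXES. #0 ThirdNotBPPR (target) — X: THIRD (prefix language of the least representative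
(A*,B*,n*) of the fundamental unit of Q(sqrt s) modulo cubes, s = square-free kernel of the
non-square input D > 1; definition inlined, choice-free over every degree-2 number field containing
sqrt s and every generator of its unit group mod +-1) is decided by no probabilistic polynomial-time
machine (tree class BPP = bp P). Hypothesis-type; refuters first; never staffed for proof. (why it
might fail: False iff a classical poly-time algorithm finds eta_s mod cubes with a small
representative WITHOUT the regulator: 3-descent on the torus x^2 - s y^2 = 4n^3, 3-adic/CM shortcuts
for Q(sqrt -3s), or index calculus reaching the R/3 ideal; none known (Kummer generation needs U and
Cl, subexponential).) [BuchmannWilliams1989, Hallgren2007, Cohen2000, Fieker2000,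
BuhlerStevenhagen2008, Literature.Barriers.QuantumAdvantage.SeparationPrerequisites]
#2 OneThirdFP (crux) — THE 3-DIVISION POINT IS CLASSICAL GIVEN THE INTEGER PART OF R: some f in FP
maps <bin s, bin r> (s > 1 square-free, r within 1 of the regulator of Q(sqrt s)) to code(A*,B*,n*),
the least representative. Route of proof: giant steps (square-and-reduce, tree
InfrastructureGiantStep) to a reduced principal ideal b = (gamma) within O(log s) of distance R/3,
keeping gamma in compact representation; alpha = +-eta*conj(gamma)^3 has both conjugates <= C
s^{3/4} (OneThirdRep), so it is recovered EXACTLY from its residues modulo one m > 4C s^{3/4}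
(compact-representation modular arithmetic, the technique of JacobsonWilliams2008 Ch. 12 = tree fact
JacobsonWilliams2008_unitResidue_mem_FP_holds); canonicalisation: every representative of key <=
that of alpha comes from a principal ideal of norm <= C' sqrt s whose reduction lies within O(log s)
of R/3 (poly many candidates, each compared by exact integer keys). [deps: OneThirdRep] [difficulty:
XL] (why it might fail: Canonicalisation is the exposure: the LEAST triple must be found, so all
small-key representatives must be enumerable from the ideals near R/3; a cluster of small-norm
principal ideals near R/3, or denominators n absorbing height, could make the candidate list
super-polynomial for some s.) [JacobsonWilliams2008, Jozsa2003, BuchmannThielWilliams1995,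
Cohen2000, Fieker2000,
Literature.Computability.Cryptography.JacobsonWilliams2008_unitResidue_mem_FP]
#3 OneThirdRep (crux) — ONE THIRD OF THE REGULATOR (the mechanism): there is C > 0 such that for
every square-free s > 1 some representative (A + B sqrt s)/n of eta K^{x3} U eta^{-1} K^{x3} has |A|
+ |B| sqrt s + n <= C s^{3/4}. Proof sketch: take the cycle element b = (gamma) with log|gamma|
closest below R/3 + (1/2) log N(b); alpha = eta conj(gamma)^3 has log|alpha| = 3 log N(b) - 3 delta
and log|conj alpha| = 3 delta for the offset delta, and the compensation e^{gap} * Q < 2 sqrt s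
between consecutive cycle elements (Jozsa2003 Prop. 31-32) bounds max(|alpha|, |conj alpha|) by
O(N(b)^{3/2}) = O(s^{3/4}). Numerically min-height/s^{3/4} <= 1.31 for 50 radicands up to 5*10^5
(periods up to 1377), attained at distance 0.33-0.40 R (folder compute/onethird_check2.py).
[difficulty: M] (why it might fail: Exponent 3/4 comes from N(b) <= 2 sqrt s for reduced ideals;
failure only via bookkeeping (half-integral units for s = 1 mod 4, the denominator n, norm -1 units)
or an s^eps loss in the gap compensation - then restate with 3/4 + eps or any polynomial bound (all
the algorithm needs).) [Jozsa2003, JacobsonWilliams2008, BuhlerStevenhagen2008, Scholz1932]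
#4 ThirdMemBQPOfFP (crux) — THE QUANTUM WRAPPER: OneThirdRep -> OneThirdFP -> THIRD in BQP (tree's
strict class: P-uniform oracle-free Clifford+T, error <= 1/3). Algorithm on input <bin D, w>: reject
squares / D <= 1 (FP); square-free kernel s of D by Shor (tree theorem factoring_mem_FBQP_holds); r
= integer part of the regulator of Q(sqrt s) by Hallgren (tree theorem
Hallgren2007_regulator_qsolvable_delim_holds, NO Riemann hypothesis; candidates certified
classically as in Jozsa sec. 10); (A*,B*,n*) := f<bin s, bin r> by OneThirdFP; accept iff w is a
prefix of the code. The least representative for D equals the least representative for s by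
definition of the language. Template: Theorems/ArithStatLadderUnitCubeMemBQP.lean (adaptive
transducer Mirror.stub_unitCubeMemBQP, isQSolvable_classicalWrap_holds). [deps: OneThirdRep,
OneThirdFP] [difficulty: L] (why it might fail: Safe mathematically; may fail AS TYPED via
uniform-family plumbing: two quantum subroutines (Shor, Hallgren) with classical certification
between them folded into ONE P-uniform family with total error <= 1/3; the FP item's promise (r
within 1 of R) must hold after the classical check.) [Hallgren2007, Jozsa2003, Shor1997,
Watrous2009, Literature.Computability.Cryptography.Hallgren2007_regulator_qsolvable_delim,
Literature.Computability.Cryptography.factoring_mem_FBQP]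
#9 ThirdMemBQP (support) — DERIVED (never staffed directly): THIRD in BQP (= the conclusion of
ThirdMemBQPOfFP, inlined there because cruxes are rendered before supports); closes by
ThirdMemBQPOfFP applied to OneThirdRep and OneThirdFP once both land. Filed so that the witness
membership has its own decl for other routes to want. [difficulty: L] [Hallgren2007, Shor1997]
#9 MirrorDominates (support) — DOMINATION BY ARITHSTATLADDER'S HYPOTHESIS (recombination made
literal; antecedents are the decls UnitCubeCriterion, MirrorRankRare, AvgFaceBeyondPrior of route
ArithStatLadder VERBATIM): UnitCubeCriterion -> MirrorRankRare -> AvgFaceBeyondPrior ->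
ThirdNotBPPR. Proof: suppose THIRD in BPP; by prefix search (poly many amplified queries) a BPP
machine computes (A*,B*,n*) on square-free inputs; for d with -d fundamental, d != 3, run it on d0 =
mirror radicand (ArithStatLadder's explicit formula) and decide by a FINITE 3-ADIC COMPUTATION
whether eta_{d0} is a cube modulo P^3 for all P | 3 of Q(sqrt 3d, zeta_3) - legitimate because
alpha* = eta^{+-1} z^3 in K^x has the same image as eta^{+-1} in K_P^x / cubes, and UnitCubeAtThree
is invariant under eta -> eta^{-1}; this gives a set T in BPP agreeing with the unit-cube language
on fundamental -d, hence (UnitCubeCriterion + MirrorRankRare) with IQ3 off a (1/6+eps)-fraction of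
every block; the LANDED theorem AvgFaceBeyondPrior.Mirror.stub_heurTransfer (=
ArithStatLadder.MirrorHeurTransfer_proof) then gives not AvgFaceBeyondPrior. Contradiction.
[difficulty: L] [Scholz1932, Washington1997, BhargavaVarma2016, BogdanovTrevisan2006,
Literature.NumberTheory.QuadraticFields.ScholzHecke_unitCubeCriterion]
#9 ThirdCoreClassical (support) — THE KILL (negation of X on the informative inputs; unranked so no
prover seat is burnt, refuters push here): a PPT machine outputs code(A*,B*,n*) with probability >=
2/3 on every square-free s > 1. Lines, cheapest first: (a) literature - any printed polynomial-time
computation of a unit modulo l-th powers / of Kummer generators of the 3-class field of Q(sqrt -3s)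
avoiding regulator and class group (Cohen2000 Ch. 5, Fieker2000, BuhlerStevenhagen2008 sec. 5 all go
through U and Cl); (b) 3-descent on the torus x^2 - s y^2 = +-4 n^3 (find the point of eta's Selmer
class); (c) CM: a relative class polynomial for the index-3 subgroup of a ray class group of Q(sqrt
-3s) in poly(log s) - degree h/3 ~ sqrt s blocks the obvious route. [difficulty: open-problem]
[Cohen2000, Fieker2000, BuhlerStevenhagen2008, BuchmannWilliams1989]

TWO-LAYER PLAN. OneThirdFP <= ThirdIdealNav (FP: from <s, r> a cycle element within O(log s) of
distance R/3 with its generator in compact representation - giant steps of InfrastructureGiantStep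
with the distance bookkeeping of RealQuadraticInfrastructureDistance) -> SmallRepExact (FP: residues
of +-eta*conj(gamma)^3 modulo one m > 4Cs^{3/4} by compact-representation arithmetic, then the
symmetric residue IS the element, by OneThirdRep) -> LeastRepEnum (FP: enumerate the poly many
principal ideals of norm <= C' sqrt s whose reduction is within O(log s) of R/3, compute each
candidate's minimal-key triple, return the least) -> OneThirdFP. ThirdMemBQPOfFP <=
SquarefreeKernelFBQP (Shor) -> RegulatorIntFBQP (Hallgren delim form, landed) -> classical wrap ->
ThirdMemBQPOfFP. k <= 3 each, depth 1; nothing filed now.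

KILL CRITERIA. (i) ThirdCoreClassical proved (a PPT for the least representative on square-free s,
equivalently a classical poly-time Kummer generator of the mirror cubic field without the regulator)
refutes ThirdNotBPPR: close `refuted:ThirdNotBPPR`; the quantum items stay as theorems (they would
then certify a classical-quantum coincidence, not an advantage). (ii) OneThirdRep refuted with
exponent 3/4 but true with a polynomial bound: misstated-class repair (restate the exponent), not a
kill. (iii) OneThirdFP refuted through canonicalisation (least triple not FP-computable from the R/3
ideal): restate the language with the canonical object replaced by the Hessian/Julia-reduced index
form of the maximal order of Q(cbrt eta + cbrt eta^{-1}) (Cremona1999, Belabas1997; tree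
CubicFieldForms/MaximalCubicRings) - one restate, same thesis. (iv) A proof that ThirdNotBPPR is
EQUIVALENT to FACT notin BPP or to Pell-hardness demotes the route to a variant of Shor's bridge:
close `superseded`. (v) BQP = BPP proved: summit refuted, route moot.

NOT DECOMPOSED YET. The internal FP lemmas of OneThirdFP (distance bookkeeping constants, the
compact-representation height bounds, the candidate enumeration for the least triple); the
uniform-family plumbing of ThirdMemBQPOfFP; the two informal supports filed right after open -
FindDominates (worst-case search hardness of constructing the cubic field of discriminant -d on the
Scholz locus implies X: from (A*,B*,n*) the field is Q[x]/(x^3 -+ 3N x - Tr alpha*), classical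
algebra) and TwoDivisionIsFactoring (the l = 2 calibration: the analogous square-class
representative is random-poly-time equivalent to factoring s, via Lagarias1980 and tree
LenstraPomeranceAmbiguousForms / AmbiguousClasses) - both need vocabulary (cubic field of a triple;
2-Sylow navigation) better fixed by a grounder. Average-case faces of X (the distance circle admits
random self-reduction in the distance coordinate, card regulator-digits-need-transcendence T4) are
deliberately not filed: X is worst-case and already dominated by ArithStatLadder's average-case
face.

CHEAPEST FALSIFIER. For the mechanism (OneThirdRep): compute min over cycle elements of
height(eta*conj(gamma)^3)/s^{3/4} - RUN this session (compute/onethird_check.py, onethird_check2.py;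
50 radicands incl. s = 300301 with period 1377): ratio <= 1.31, argmin at distance (0.33-0.40)R;
bonus: for D = 5 mod 8 with the order unit = eps0^3 the R/3 step returns alpha = -8, i.e. it FINDS
the cube root eps0 - the mechanism behaves exactly as claimed. For X: a literature lookup for a
classical polynomial-time computation of a real quadratic unit modulo cubes / of the Kummer
generator of the 3-class field of Q(sqrt -3s) that avoids both regulator and class group
(BuhlerStevenhagen2008 pp. 507, 512, 526-530 and Cohen2000 Ch. 5 go through U and Cl:
subexponential); refuters should also try s with tiny class number of Q(sqrt -3s), where CM class
polynomials are cheap, to see whether THIRD restricted there is classical (it may be - that would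
bound the hard core, not kill X).

NUMBERS. Height of the 3-division representative: <= 1.31 s^{3/4} observed (50 radicands, s <=
524287), theory O(s^{3/4}) with the constant from e^{gap} Q < 2 sqrt s; l-division representative in
general ~ s^{l/4} (l = 2: the ambiguous form, norm <= sqrt s). Classical records: regulator / unit
group of Q(sqrt s) in L_s[1/2] under GRH (Buchmann, Vollmer), O(s^{1/4+eps}) unconditionally
(JacobsonWilliams2008 Ch. 7, 10); Kummer 3-class-field generation = (Cl, U of Q(sqrt s) or Q(sqrt
-3s)) + linear algebra (Cohen2000 Ch. 5, Fieker2000). Density of the Scholz locus among fundamental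
-d: P(3 | h(-d)) ~ 0.44 (Cohen-Lenstra) minus the mirror-rare part <= 1/6 (BhargavaVarma2016), so >=
0.27.

DEFINITION REQUESTS. None needed at open (everything is inlined over Mathlib's
NumberField.RingOfIntegers / NumberField.Units.regulator and the tree's boolPair / encodeNat / BQP /
BPP / FP / RandAlg). Wanted later, for the informal supports: a Literature definition
`kummerCubicField (s : N)` := Q(cbrt eta + cbrt eta^{-1}) as a `NumberField` with its index form
(topic Literature/NumberTheory/CubicFields, next to CubicFieldForms), and a cite fact for
Lagarias1980 (2-Sylow subgroup of the narrow class group in random polynomial time given the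
factorisation).

Novelty: Searches (2026-08-16): `lit search --hybrid "factoring reduces to Pell equation regulator real
quadratic field fundamental unit"` (20 local: JW pp.157-158 read, Cohen1993, Buell), `lit search
--hybrid "Kummer theory algorithm cyclic cubic extension virtual units Hilbert class field
computation"` (10: BuhlerStevenhagen2008 pp. 497-540 materialised and read - Schoof p.507 compact
representations/jumping, Cohen-Stevenhagen p.512 and sec. 5 pp.526-530), crossref "quantum algorithm
ray class groups Hilbert class fields Eisentrager Hallgren" (-> doi:10.1137/1.9781611973075.40,
paywalled, acq-06183), crossref Lagarias 1980 (doi:10.2307/1998017), Buchmann-Williams CRYPTO 89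
(doi:10.1007/0-387-34805-0_31), Fieker 2000 (doi:10.1090/s0025-5718-00-01255-2), Cremona 1999
(doi:10.1112/s1461157000000073); `lit galaxy search "ray class groups Hilbert class fields quantum"
--star all` (0) and `--star pdf "Algorithms for ray class groups"` (0); `lit read arxiv:0812.0380
--grep` (ChildsVandam2010 sec. 5.5 p.23: "factoring reduces to Pell, Pell to PIP [BW89]"), `lit read
arxiv:quant-ph/0302134`; tree: lean search for JacobsonWilliams2008_unitResidue /
Hallgren2007_regulator / BinaryCubic / Delone / ScholzHecke / Infrastructure (all present); cards
read: regulator-digits-need-transcendence (T3 UnitRes/PIP languages), flows-torsion-totality,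
linking-not-braiding, cubic-thue-in-bqp title; routes read: ArithStatLadder, CentralFactorial,
MobiusLadder, WhiteBoxWalk, Shor, CubicForrelation, AreaUncerta  [refs: 10.1137/1.9781611973075.40, 10.2307/1998017, 10.1007/0-387-34805-0_31, 10.1090/s0025-5718-00-01255-2, 10.1112/s1461157000000073, 10.1137/1.9781611973075.40:, 0812.0380, quant-ph/0302134, doi:10.1137/1.9781611973075.40, doi:10.2307/1998017, doi:10.1007/0-387-34805-0_31, doi:10.1090/s0025-5718-00-01255-2, doi:10.1112/s1461157000000073, arxiv:0812.0380, arxiv:quant-ph/0302134, Cohen1993, BuhlerSteven]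

Barriers (technique_class: conditional-bridge, quantum-algorithm, infrastructure, kummer): - technique_class: conditional-bridge, quantum-algorithm, infrastructure, kummer (also:
reflection-theorems, HSP over R)
- Literature.Barriers.QuantumAdvantage.SeparationPrerequisites: APPLIES to X = ThirdNotBPP and is
not evaded (with ThirdMemBQP, X IS BQP notsubset BPP, hence PP notsubset BPP, P != PSPACE); confined
to the one hypothesis-type item, which is never staffed for proof; every other item is theorem-type
(OneThirdRep: arithmetic; OneThirdFP: classical algorithmics; ThirdMemBQPOfFP: plumbing over landed
Hallgren/Shor theorems; MirrorDominates: from landed MirrorHeurTransfer).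
- Literature.Barriers.QuantumAdvantage.PromiseLiftRelativization: EVADED - the witness is a TOTAL
language (least representative exists for every non-square D > 1; membership with empty prefix is
the P-decidable condition "D > 1 non-square"), the quantum family is gapped on every input because
each sub-answer (square-free kernel, candidate integer near R, the FP output) is classically
CERTIFIED before use; no PlLift, no promise.
- Literature.Barriers.QuantumAdvantage.TotalFunctionSpeedupLimit: consistent - the speedup is for a
STRUCTURED problem (hidden period R over the reals), the textbook evasion; nothing black-box is
claimed.
- Literature.Barriers.QuantumAdvantage.Relativization: the bridge THIRD in BQP relativizes
harmlessly (it is an algorithm); X would need a non-relativizing proof and none is attempted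
(hypothesis-type). Literature.Barriers.QuantumAdvantage.Algebrization likewise not e

History (route lifecycle, newest last):
- 2026-08-16T15:17:14Z · AUTO-CRUX (open): ThirdNotBPP — hypotheses of the deciding theorem that nothing in the route derives are cruxes (planner-plan-lens-QuantumAdvantage-recomb-0)
- 2026-08-16T15:35:12Z · rev 1: restated MirrorDominates (stmt-QuantumAdvantage-15717) — cone repair (route-repair seat): drop import Literature.NumberTheory.QuadraticFields.ThreeTorsion — it alone pulls 92 extra modules incl. EllipticCurves/Heegner (planner-rrepair-QuantumAdvantage-RegulatorThir-2084f307-0)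
- 2026-08-16T16:44:02Z · BROKEN — ThirdNotBPP (stmt-QuantumAdvantage-15712, crux) refuted by Summit.QuantumAdvantage.QuantumAdvantage.Theorems.RegulatorThirdThirdNotBPP_refuted @ b65922813997 (refuter-rreview-0816T15-2-0)
- 2026-08-16T17:00:44Z · rev 2: restated ThirdNotBPP (stmt-QuantumAdvantage-15712 refuted), OneThirdFP (stmt-QuantumAdvantage-15713), OneThirdRep (stmt-QuantumAdvantage-15714), ThirdMemBQPOfFP (stmt-QuantumAdvantage-15715), ThirdMemBQP (stmt-QuantumAdvantage-15716), ThirdCoreClassical (stmt-QuantumAdvantage-15718), MirrorDominates (stmt-Quantu (planner-rfix-QuantumAdvantage-RegulatorThird-2084f307-0)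
- 2026-08-16T17:00:44Z · REPAIRED (restate ThirdNotBPP, OneThirdFP, OneThirdRep, ThirdMemBQPOfFP, ThirdMemBQP, ThirdCoreClassical, MirrorDominates, Assembl) — back to open: repair: ThirdNotBPP (stmt-QuantumAdvantage-15712) refuted-MISSTATED by Theorems.RegulatorThirdThirdNotBPP_refuted @ b65922813997 (the inlined cube-class clause (planner-rfix-QuantumAdvantage-RegulatorThird-2084f307-0)
- 2026-08-26T13:37:50Z · DORMANT — reconciler: no traction for 7.1 d (last activity item-proof-filed at 2026-08-19T10:05:31Z); parked, not closed — `ledger route dormant route-QuantumAdvantage-Re (operator:999:2982097)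

sub-problem: QuantumAdvantage · status: dormant · opened planner-plan-lens-QuantumAdvantage-recomb-0 2026-08-16T15:16:58Z · rev 3 · ledger route-QuantumAdvantage-RegulatorThird
GENERATED by the gate from the ledger (D-0016/17). Provers cite these decls: `theorem foo : Summit.QuantumAdvantage.QuantumAdvantage.Theses.RegulatorThird.<Decl> := …` in Summits/QuantumAdvantage/QuantumAdvantage/Theorems/<Name>.lean.
-/

namespace Summit.QuantumAdvantage.QuantumAdvantage.Theses.RegulatorThird

open scoped BigOperators Topology Manifold Classical MeasureTheory ProbabilityTheory Matrix InnerProductSpace ComplexConjugate ContinuousMap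
open Filter Set Function TopologicalSpace MeasureTheory

attribute [summit_statement] _root_.QuantumAdvantage

open Literature.QuantumAdvantage

/-- item stmt-QuantumAdvantage-15981 · crux · rank 0 · open · by planner
why it might fail: False iff a classical poly-time algorithm finds eta_s mod cubes with a small representative WITHOUT the regulator: 3-descent on the torus x^2 - s y^2 = 4n^3, 3-adic/CM shortcuts for Q(sqrt -3s), or index calculus reaching the R/3 ideal; none known (Kummer generation needs U and Cl, subexponential).
sources: BuchmannWilliams1989, Hallgren2007, Cohen2000, Fieker2000, BuhlerStevenhagen2008, Literature.Barriers.QuantumAdvantage.SeparationPrerequisites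
[target] REPAIRED 2026-08-16 (route-repair after Theorems.RegulatorThirdThirdNotBPP_refuted,
refuted-misstated): the cube-class clause now reads `∃ z : K, z ≠ 0 ∧ ((A+Bα)/n = u z³ ∨ (A+Bα)/n =
u⁻¹ z³)` — membership in η·K^{×3} ∪ η⁻¹·K^{×3} as the thesis intends; the junk witness (A,B,n,z) =
(0,0,1,0) is gone. X (= ThirdNotBPPR, successor of the REFUTED ThirdNotBPP
stmt-QuantumAdvantage-15712, which stays in the negatives index): THIRD (prefix language of the
least representative (A*,B*,n*) of the fundamental unit of Q(sqrt s) modulo cubes, s = square-free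
kernel of the non-square input D > 1; definition inlined, choice-free over every degree-2 number
field containing sqrt s and every generator of its unit group mod +-1) is decided by no
probabilistic polynomial-time machine (tree class BPP = bp P). Hypothesis-type; refuters first;
never staffed for proof. -/
@[route_item "route-QuantumAdvantage-RegulatorThird", crux]
def ThirdNotBPPR : Prop :=
  {x : List Bool | ∃ (D n : ℕ) (w : List Bool) (A B : ℤ), x = Literature.Computability.Complexity.boolPair (Computability.encodeNat D) w ∧ ¬ IsSquare D ∧ 1 < D ∧ ((∀ s f : ℕ, D = f ^ 2 * s → Squarefree s → (0 < n ∧ ∀ (K : Type) [Field K] [NumberField K], Module.finrank ℚ K = 2 → ∀ α : K, α ^ 2 = (s : K) → ∀ u : (NumberField.RingOfIntegers K)ˣ, (∀ v : (NumberField.RingOfIntegers K)ˣ, ∃ m : ℤ, v = u ^ m ∨ v = -(u ^ m)) → ∃ z : K, z ≠ 0 ∧ (((A : K) + (B : K) * α) / (n : K) = ((u : NumberField.RingOfIntegers K) : K) * z ^ 3 ∨ ((A : K) + (B : K) * α) / (n : K) = ((u⁻¹ : (NumberField.RingOfIntegers K)ˣ) : NumberField.RingOfIntegers K) * z ^ 3)))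 ∧ ∀ (A' B' : ℤ) (n' : ℕ), (∀ s f : ℕ, D = f ^ 2 * s → Squarefree s → (0 < n' ∧ ∀ (K : Type) [Field K] [NumberField K], Module.finrank ℚ K = 2 → ∀ α : K, α ^ 2 = (s : K) → ∀ u : (NumberField.RingOfIntegers K)ˣ, (∀ v : (NumberField.RingOfIntegers K)ˣ, ∃ m : ℤ, v = u ^ m ∨ v = -(u ^ m)) → ∃ z : K, z ≠ 0 ∧ (((A' : K) + (B' : K) * α) / (n' : K) = ((u : NumberField.RingOfIntegers K) : K) * z ^ 3 ∨ ((A' : K) + (B' : K) * α) / (n' : K) = ((u⁻¹ : (NumberField.RingOfIntegers K)ˣ) : NumberField.RingOfIntegers K) * z ^ 3))) → (|A| + |B| + n < |A'| + |B'| + n' ∨ (|A| + |B| + n = |A'| + |B'| + n' ∧ (A < A' ∨ (A = A' ∧ (B < B' ∨ (B = B' ∧ n ≤ n'))))))) ∧ w <+: Literature.Computability.Complexity.boolPair (Literature.Computability.Complexity.boolPair (Computability.encodeNat A.natAbs) (Computability.encodeNat B.natAbs)) (Literature.Computability.Complexity.boolPair (Computability.encodeNat n) [decide (A < 0), decide (B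 < 0)])} ∉ Literature.Computability.Complexity.BPP

-- earlier OneThirdFP (stmt-QuantumAdvantage-15713, replaced 2026-08-16T17:00:44Z -> stmt-QuantumAdvantage-15982): retired by None — ∃ g ∈ Literature.Computability.Complexity.FP, ∀ (s r : ℕ), Squarefree s → 1 < s → (∀ (K : Type) [Field K] [NumberField K], Module.finrank ℚ K = 2 → (∃ α : K, α ^ 2 = (s : K)) → |NumberField.Units.regulator K - (r : ℝ)| ≤ 1) → ∀ (A B : ℤ) (n : ℕ), ((0 < n ∧ ∀ (K : Type) 
/-- item stmt-QuantumAdvantage-15982 · crux · rank 2 · open · by planner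
why it might fail: Canonicalisation is the exposure: the LEAST triple must be found, so all small-key representatives must be enumerable from the ideals near R/3; a cluster of small-norm principal ideals near R/3, or denominators n absorbing height, could make the candidate list super-polynomial for some s.
sources: JacobsonWilliams2008, Jozsa2003, BuchmannThielWilliams1995, Cohen2000, Fieker2000, Literature.Computability.Cryptography.JacobsonWilliams2008_unitResidue_mem_FP
[crux] REPAIRED 2026-08-16 (route-repair after Theorems.RegulatorThirdThirdNotBPP_refuted,
refuted-misstated): the cube-class clause now reads `∃ z : K, z ≠ 0 ∧ ((A+Bα)/n = u z³ ∨ (A+Bα)/n =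
u⁻¹ z³)` — membership in η·K^{×3} ∪ η⁻¹·K^{×3} as the thesis intends; the junk witness (A,B,n,z) =
(0,0,1,0) is gone. THE 3-DIVISION POINT IS CLASSICAL GIVEN THE INTEGER PART OF R: some f in FP maps
<bin s, bin r> (s > 1 square-free, r within 1 of the regulator of Q(sqrt s)) to code(A*,B*,n*), the
least representative. Route of proof: giant steps (square-and-reduce, tree InfrastructureGiantStep)
to a reduced principal ideal b = (gamma) within O(log s) of distance R/3, keeping gamma in compact
representation; alpha = +-eta*conj(gamma)^3 has both conjugates <= C s^{3/4} (OneThirdRep), so it is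
recovered EXACTLY from its residues modulo one m > 4C s^{3/4} (compact-representation modular
arithmetic, the technique of JacobsonWilliams2008 Ch. 12 = tree fact
JacobsonWilliams2008_unitResidue_mem_FP_holds); canonicalisation: every representative of key <=
that of alpha comes from a principal ideal of norm <= C' sqrt s whose reduction lies within O(log s)
of R/3 (poly many candidates, each compared by ex -/
@[route_item "route-QuantumAdvantage-RegulatorThird", crux]
def OneThirdFP : Prop :=
  ∃ g ∈ Literature.Computability.Complexity.FP, ∀ (s r : ℕ), Squarefree s → 1 < s → (∀ (K : Type) [Field K] [NumberField K], Module.finrank ℚ K = 2 → (∃ α : K, α ^ 2 = (s : K)) → |NumberField.Units.regulator K - (r : ℝ)| ≤ 1) → ∀ (A B : ℤ) (n : ℕ), ((0 < n ∧ ∀ (K : Type) [Field K] [NumberField K], Module.finrank ℚ K = 2 → ∀ α : K, α ^ 2 = (s : K) → ∀ u : (NumberField.RingOfIntegers K)ˣ, (∀ v : (NumberField.RingOfIntegers K)ˣ, ∃ m : ℤ, v = u ^ m ∨ v = -(u ^ m)) → ∃ z : K, z ≠ 0 ∧ (((A : K) + (B : K) * α) / (n : K) = ((u : NumberField.RingOfIntegers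 K) : K) * z ^ 3 ∨ ((A : K) + (B : K) * α) / (n : K) = ((u⁻¹ : (NumberField.RingOfIntegers K)ˣ) : NumberField.RingOfIntegers K) * z ^ 3)) ∧ ∀ (A' B' : ℤ) (n' : ℕ), (0 < n' ∧ ∀ (K : Type) [Field K] [NumberField K], Module.finrank ℚ K = 2 → ∀ α : K, α ^ 2 = (s : K) → ∀ u : (NumberField.RingOfIntegers K)ˣ, (∀ v : (NumberField.RingOfIntegers K)ˣ, ∃ m : ℤ, v = u ^ m ∨ v = -(u ^ m)) → ∃ z : K, z ≠ 0 ∧ (((A' : K) + (B' : K) * α) / (n' : K) = ((u : NumberField.RingOfIntegers K) : K) * z ^ 3 ∨ ((A' : K) + (B' : K) * α) / (n' : K) = ((u⁻¹ : (NumberField.RingOfIntegers K)ˣ) : NumberField.RingOfIntegers K) * z ^ 3)) → (|A| + |B| + n < |A'| + |B'| + n' ∨ (|A| + |B| + n = |A'| + |B'| + n' ∧ (A < A' ∨ (A = A' ∧ (B < B' ∨ (B = B' ∧ n ≤ n'))))))) → g (Literature.Computability.Complexity.boolPair (Computability.encodeNat s) (Computability.encodeNat r)) = Literature.Computability.Complexity.boolPair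 (Literature.Computability.Complexity.boolPair (Computability.encodeNat A.natAbs) (Computability.encodeNat B.natAbs)) (Literature.Computability.Complexity.boolPair (Computability.encodeNat n) [decide (A < 0), decide (B < 0)])

-- earlier OneThirdRep (stmt-QuantumAdvantage-15714, replaced 2026-08-16T17:00:44Z -> stmt-QuantumAdvantage-15983): retired by None — ∃ C : ℝ, 0 < C ∧ ∀ s : ℕ, Squarefree s → 1 < s → ∃ (A B : ℤ) (n : ℕ), (0 < n ∧ ∀ (K : Type) [Field K] [NumberField K], Module.finrank ℚ K = 2 → ∀ α : K, α ^ 2 = (s : K) → ∀ u : (NumberField.RingOfIntegers K)ˣ, (∀ v : (NumberField.RingOfIntegers K)ˣ, ∃ m : ℤ, v = u ^ m 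
/-- item stmt-QuantumAdvantage-15983 · crux · rank 3 · open · by planner
why it might fail: Exponent 3/4 comes from N(b) <= 2 sqrt s for reduced ideals; failure only via bookkeeping (half-integral units for s = 1 mod 4, the denominator n, norm -1 units) or an s^eps loss in the gap compensation - then restate with 3/4 + eps or any polynomial bound (all the algorithm needs).
sources: Jozsa2003, JacobsonWilliams2008, BuhlerStevenhagen2008, Scholz1932
[crux] REPAIRED 2026-08-16 (route-repair after Theorems.RegulatorThirdThirdNotBPP_refuted,
refuted-misstated): the cube-class clause now reads `∃ z : K, z ≠ 0 ∧ ((A+Bα)/n = u z³ ∨ (A+Bα)/n =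
u⁻¹ z³)` — membership in η·K^{×3} ∪ η⁻¹·K^{×3} as the thesis intends; the junk witness (A,B,n,z) =
(0,0,1,0) is gone. ONE THIRD OF THE REGULATOR (the mechanism): there is C > 0 such that for every
square-free s > 1 some representative (A + B sqrt s)/n of eta K^{x3} U eta^{-1} K^{x3} has |A| + |B|
sqrt s + n <= C s^{3/4}. Proof sketch: take the cycle element b = (gamma) with log|gamma| closest
below R/3 + (1/2) log N(b); alpha = eta conj(gamma)^3 has log|alpha| = 3 log N(b) - 3 delta and
log|conj alpha| = 3 delta for the offset delta, and the compensation e^{gap} * Q < 2 sqrt s between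
consecutive cycle elements (Jozsa2003 Prop. 31-32) bounds max(|alpha|, |conj alpha|) by
O(N(b)^{3/2}) = O(s^{3/4}). Numerically min-height/s^{3/4} <= 1.31 for 50 radicands up to 5*10^5
(periods up to 1377), attained at distance 0.33-0.40 R (folder compute/onethird_check2.py).
ALTERNATIVE LINE (idea-node evidence idea-minkowski-cube-box.md + SketchOneThird.lean on
stmt-QuantumAdvantage-15714, numbers re-checked by -/
@[route_item "route-QuantumAdvantage-RegulatorThird", crux]
def OneThirdRep : Prop :=
  ∃ C : ℝ, 0 < C ∧ ∀ s : ℕ, Squarefree s → 1 < s → ∃ (A B : ℤ) (n : ℕ), (0 < n ∧ ∀ (K : Type) [Field K] [NumberField K], Module.finrank ℚ K = 2 → ∀ α : K, α ^ 2 = (s : K) → ∀ u : (NumberField.RingOfIntegers K)ˣ, (∀ v : (NumberField.RingOfIntegers K)ˣ, ∃ m : ℤ, v = u ^ m ∨ v = -(u ^ m)) → ∃ z : K, z ≠ 0 ∧ (((A : K) + (B : K) * α) / (n : K) = ((u : NumberField.RingOfIntegers K) : K) * z ^ 3 ∨ ((A : K) + (B : K) * α) / (n : K) = ((u⁻¹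 : (NumberField.RingOfIntegers K)ˣ) : NumberField.RingOfIntegers K) * z ^ 3)) ∧ (|A| : ℝ) + |B| * Real.sqrt s + n ≤ C * (s : ℝ) ^ ((3 : ℝ) / 4)

-- earlier ThirdMemBQPOfFP (stmt-QuantumAdvantage-15715, replaced 2026-08-16T17:00:44Z -> stmt-QuantumAdvantage-15984): retired by None — OneThirdRep → OneThirdFP → {x : List Bool | ∃ (D n : ℕ) (w : List Bool) (A B : ℤ), x = Literature.Computability.Complexity.boolPair (Computability.encodeNat D) w ∧ ¬ IsSquare D ∧ 1 < D ∧ ((∀ s f : ℕ, D = f ^ 2 * s → Squarefree s → (0 < n ∧ ∀ (K : Type) [Field K] [N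
/-- item stmt-QuantumAdvantage-15984 · crux · rank 4 · open · by planner
why it might fail: Safe mathematically; may fail AS TYPED via uniform-family plumbing: two quantum subroutines (Shor, Hallgren) with classical certification between them folded into ONE P-uniform family with total error <= 1/3; the FP item's promise (r within 1 of R) must hold after the classical check.
sources: Hallgren2007, Jozsa2003, Shor1997, Watrous2009, Literature.Computability.Cryptography.Hallgren2007_regulator_qsolvable_delim, Literature.Computability.Cryptography.factoring_mem_FBQP
[crux] REPAIRED 2026-08-16 (route-repair after Theorems.RegulatorThirdThirdNotBPP_refuted,
refuted-misstated): the cube-class clause now reads `∃ z : K, z ≠ 0 ∧ ((A+Bα)/n = u z³ ∨ (A+Bα)/n =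
u⁻¹ z³)` — membership in η·K^{×3} ∪ η⁻¹·K^{×3} as the thesis intends; the junk witness (A,B,n,z) =
(0,0,1,0) is gone. THE QUANTUM WRAPPER: OneThirdRep -> OneThirdFP -> THIRD in BQP (tree's strict
class: P-uniform oracle-free Clifford+T, error <= 1/3). Algorithm on input <bin D, w>: reject
squares / D <= 1 (FP); square-free kernel s of D by Shor (tree theorem factoring_mem_FBQP_holds); r
= integer part of the regulator of Q(sqrt s) by Hallgren (tree theorem
Hallgren2007_regulator_qsolvable_delim_holds, NO Riemann hypothesis; candidates certified
classically as in Jozsa sec. 10); (A*,B*,n*) := f<bin s, bin r> by OneThirdFP; accept iff w is a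
prefix of the code. The least representative for D equals the least representative for s by
definition of the language. Template: Theorems/ArithStatLadderUnitCubeMemBQP.lean (adaptive
transducer Mirror.stub_unitCubeMemBQP, isQSolvable_classicalWrap_holds). [deps: OneThirdRep,
OneThirdFP] [difficulty: L] -/
@[route_item "route-QuantumAdvantage-RegulatorThird", crux]
def ThirdMemBQPOfFP : Prop :=
  OneThirdRep → OneThirdFP → {x : List Bool | ∃ (D n : ℕ) (w : List Bool) (A B : ℤ), x = Literature.Computability.Complexity.boolPair (Computability.encodeNat D) w ∧ ¬ IsSquare D ∧ 1 < D ∧ ((∀ s f : ℕ, D = f ^ 2 * s → Squarefree s → (0 < n ∧ ∀ (K : Type) [Field K] [NumberField K], Module.finrank ℚ K = 2 → ∀ α : K, α ^ 2 = (s : K) → ∀ u : (NumberField.RingOfIntegers K)ˣ, (∀ v : (NumberField.RingOfIntegers K)ˣ, ∃ m : ℤ, v = u ^ m ∨ v = -(u ^ m)) → ∃ z : K, z ≠ 0 ∧ (((A : K) + (B : K) * α) / (n : K) = ((u : NumberField.RingOfIntegers K) : K) * z ^ 3 ∨ ((A : K) + (B : K) * α) / (n : K) = ((u⁻¹ : (NumberField.RingOfIntegers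 K)ˣ) : NumberField.RingOfIntegers K) * z ^ 3))) ∧ ∀ (A' B' : ℤ) (n' : ℕ), (∀ s f : ℕ, D = f ^ 2 * s → Squarefree s → (0 < n' ∧ ∀ (K : Type) [Field K] [NumberField K], Module.finrank ℚ K = 2 → ∀ α : K, α ^ 2 = (s : K) → ∀ u : (NumberField.RingOfIntegers K)ˣ, (∀ v : (NumberField.RingOfIntegers K)ˣ, ∃ m : ℤ, v = u ^ m ∨ v = -(u ^ m)) → ∃ z : K, z ≠ 0 ∧ (((A' : K) + (B' : K) * α) / (n' : K) = ((u : NumberField.RingOfIntegers K) : K) * z ^ 3 ∨ ((A' : K) + (B' : K) * α) / (n' : K) = ((u⁻¹ : (NumberField.RingOfIntegers K)ˣ) : NumberField.RingOfIntegers K) * z ^ 3))) → (|A| + |B| + n < |A'| + |B'| + n' ∨ (|A| + |B| + n = |A'| + |B'| + n' ∧ (A < A' ∨ (A = A' ∧ (B < B' ∨ (B = B' ∧ n ≤ n'))))))) ∧ w <+: Literature.Computability.Complexity.boolPair (Literature.Computability.Complexity.boolPair (Computability.encodeNat A.natAbs) (Computability.encodeNat B.natAbs)) (Literature.Computability.Complexity.boolPair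 (Computability.encodeNat n) [decide (A < 0), decide (B < 0)])} ∈ Literature.Computability.Cryptography.BQP

-- item stmt-QuantumAdvantage-15732 · support · rank 9 · open · by planner — informal only, no Lean statement yet:
--   [support] DOMINATION BY SEARCH HARDNESS (informal until a grounder fixes the vocabulary
--   `kummerCubicField s` := Q(cbrt eta_s + cbrt eta_s^{-1}) as a NumberField, topic
--   Literature/NumberTheory/CubicFields next to CubicFieldForms): if THIRD is in BPP then some PPT,
--   given any d with -d a fundamental discriminant and UnitCubeAtThree d (ArithStatLadder /
--   ScholzHeckeUnitCriterion), outputs with probability >= 2/3 a monic integer cubic x^3 + px + q with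
--   Q[x]/(x^3+px+q) isomorphic to the cubic field of discriminant exactly -d attached to the unit
--   (Scholz 1932 direction (i)); proof: prefix-search the l

-- item stmt-QuantumAdvantage-15733 · support · rank 9 · open · by planner — informal only, no Lean statement yet:
--   [support] THE l = 2 CALIBRATION (why 3 is the first factoring-independent division point; informal
--   until the 2-Sylow navigation vocabulary is fixed — tree files LenstraPomeranceAmbiguousForms*,
--   AmbiguousClasses, ReducedIdealCycleOfClass give most of it): the analogous SQUARE-class object — the
--   least (A,B,n) with (A + B sqrt s)/n in eta_s K^{x2} (carried by the principal ambiguous ideal at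
--   distance R/2, the Gauss–Shanks–Schoof factorisation of the discriminant) — is computable in RANDOM
--   POLYNOMIAL TIME from the complete factorisation of s (Lagarias 1980: the 2-Sylow subgroup of the
--   narrow class

-- earlier ThirdMemBQP (stmt-QuantumAdvantage-15716, replaced 2026-08-16T17:00:44Z -> stmt-QuantumAdvantage-15985): retired by None — {x : List Bool | ∃ (D n : ℕ) (w : List Bool) (A B : ℤ), x = Literature.Computability.Complexity.boolPair (Computability.encodeNat D) w ∧ ¬ IsSquare D ∧ 1 < D ∧ ((∀ s f : ℕ, D = f ^ 2 * s → Squarefree s → (0 < n ∧ ∀ (K : Type) [Field K] [NumberField K], Module.finrank ℚ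
/-- item stmt-QuantumAdvantage-15985 · support · rank 9 · open · by planner
sources: Hallgren2007, Shor1997
[support] REPAIRED 2026-08-16 (route-repair after Theorems.RegulatorThirdThirdNotBPP_refuted,
refuted-misstated): the cube-class clause now reads `∃ z : K, z ≠ 0 ∧ ((A+Bα)/n = u z³ ∨ (A+Bα)/n =
u⁻¹ z³)` — membership in η·K^{×3} ∪ η⁻¹·K^{×3} as the thesis intends; the junk witness (A,B,n,z) =
(0,0,1,0) is gone. DERIVED (never staffed directly): THIRD in BQP (= the conclusion of
ThirdMemBQPOfFP, inlined there because cruxes are rendered before supports); closes by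
ThirdMemBQPOfFP applied to OneThirdRep and OneThirdFP once both land. Filed so that the witness
membership has its own decl for other routes to want. [difficulty: L] -/
@[route_item "route-QuantumAdvantage-RegulatorThird"]
def ThirdMemBQP : Prop :=
  {x : List Bool | ∃ (D n : ℕ) (w : List Bool) (A B : ℤ), x = Literature.Computability.Complexity.boolPair (Computability.encodeNat D) w ∧ ¬ IsSquare D ∧ 1 < D ∧ ((∀ s f : ℕ, D = f ^ 2 * s → Squarefree s → (0 < n ∧ ∀ (K : Type) [Field K] [NumberField K], Module.finrank ℚ K = 2 → ∀ α : K, α ^ 2 = (s : K) → ∀ u : (NumberField.RingOfIntegers K)ˣ, (∀ v : (NumberField.RingOfIntegers K)ˣ, ∃ m : ℤ, v = u ^ m ∨ v = -(u ^ m)) → ∃ z : K, z ≠ 0 ∧ (((A : K) + (B : K) * α) / (n : K) = ((u : NumberField.RingOfIntegers K) : K) * z ^ 3 ∨ ((A : K) + (B : K) * α) / (n : K) = ((u⁻¹ : (NumberField.RingOfIntegers K)ˣ) : NumberField.RingOfIntegers K) * z ^ 3))) ∧ ∀ (A' B' : ℤ) (n' : ℕ), (∀ s f : ℕ, D = f ^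 2 * s → Squarefree s → (0 < n' ∧ ∀ (K : Type) [Field K] [NumberField K], Module.finrank ℚ K = 2 → ∀ α : K, α ^ 2 = (s : K) → ∀ u : (NumberField.RingOfIntegers K)ˣ, (∀ v : (NumberField.RingOfIntegers K)ˣ, ∃ m : ℤ, v = u ^ m ∨ v = -(u ^ m)) → ∃ z : K, z ≠ 0 ∧ (((A' : K) + (B' : K) * α) / (n' : K) = ((u : NumberField.RingOfIntegers K) : K) * z ^ 3 ∨ ((A' : K) + (B' : K) * α) / (n' : K) = ((u⁻¹ : (NumberField.RingOfIntegers K)ˣ) : NumberField.RingOfIntegers K) * z ^ 3))) → (|A| + |B| + n < |A'| + |B'| + n' ∨ (|A| + |B| + n = |A'| + |B'| + n' ∧ (A < A' ∨ (A = A' ∧ (B < B' ∨ (B = B' ∧ n ≤ n'))))))) ∧ w <+: Literature.Computability.Complexity.boolPair (Literature.Computability.Complexity.boolPair (Computability.encodeNat A.natAbs) (Computability.encodeNat B.natAbs)) (Literature.Computability.Complexity.boolPair (Computability.encodeNat n) [decide (A < 0), decide (B < 0)])} ∈ Literature.Computability.Cryptography.BQP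

-- earlier ThirdCoreClassical (stmt-QuantumAdvantage-15718, replaced 2026-08-16T17:00:44Z -> stmt-QuantumAdvantage-15986): retired by None — ∃ M : Literature.Computability.Complexity.RandAlg (List Bool) (List Bool), Literature.Computability.Cryptography.IsPPT M id ∧ ∀ s : ℕ, Squarefree s → 1 < s → ∀ (A B : ℤ) (n : ℕ), ((0 < n ∧ ∀ (K : Type) [Field K] [NumberField K], Module.finrank ℚ K = 2 → ∀ α : K,
/-- item stmt-QuantumAdvantage-15986 · support · rank 9 · open · by planner
sources: Cohen2000, Fieker2000, BuhlerStevenhagen2008, BuchmannWilliams1989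
[support] REPAIRED 2026-08-16 (route-repair after Theorems.RegulatorThirdThirdNotBPP_refuted,
refuted-misstated): the cube-class clause now reads `∃ z : K, z ≠ 0 ∧ ((A+Bα)/n = u z³ ∨ (A+Bα)/n =
u⁻¹ z³)` — membership in η·K^{×3} ∪ η⁻¹·K^{×3} as the thesis intends; the junk witness (A,B,n,z) =
(0,0,1,0) is gone. THE KILL (negation of X on the informative inputs; unranked so no prover seat is
burnt, refuters push here): a PPT machine outputs code(A*,B*,n*) with probability >= 2/3 on every
square-free s > 1. Lines, cheapest first: (a) literature - any printed polynomial-time computation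
of a unit modulo l-th powers / of Kummer generators of the 3-class field of Q(sqrt -3s) avoiding
regulator and class group (Cohen2000 Ch. 5, Fieker2000, BuhlerStevenhagen2008 sec. 5 all go through
U and Cl); (b) 3-descent on the torus x^2 - s y^2 = +-4 n^3 (find the point of eta's Selmer class);
(c) CM: a relative class polynomial for the index-3 subgroup of a ray class group of Q(sqrt -3s) in
poly(log s) - degree h/3 ~ sqrt s blocks the obvious route. [difficulty: open-problem] -/
@[route_item "route-QuantumAdvantage-RegulatorThird"]
def ThirdCoreClassical : Prop :=
  ∃ M : Literature.Computability.Complexity.RandAlg (List Bool) (List Bool), Literature.Computability.Cryptography.IsPPT M id ∧ ∀ s : ℕ, Squarefree s → 1 < s → ∀ (A B : ℤ) (n : ℕ), ((0 < n ∧ ∀ (K : Type) [Field K] [NumberField K], Module.finrank ℚ K = 2 → ∀ α : K, α ^ 2 = (s : K) → ∀ u : (NumberField.RingOfIntegers K)ˣ, (∀ v : (NumberField.RingOfIntegers K)ˣ, ∃ m : ℤ, v = u ^ m ∨ v = -(u ^ m)) → ∃ z : K, z ≠ 0 ∧ (((A : K) + (B : K) * α) / (n : K) = ((u : NumberField.RingOfIntegers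 K) : K) * z ^ 3 ∨ ((A : K) + (B : K) * α) / (n : K) = ((u⁻¹ : (NumberField.RingOfIntegers K)ˣ) : NumberField.RingOfIntegers K) * z ^ 3)) ∧ ∀ (A' B' : ℤ) (n' : ℕ), (0 < n' ∧ ∀ (K : Type) [Field K] [NumberField K], Module.finrank ℚ K = 2 → ∀ α : K, α ^ 2 = (s : K) → ∀ u : (NumberField.RingOfIntegers K)ˣ, (∀ v : (NumberField.RingOfIntegers K)ˣ, ∃ m : ℤ, v = u ^ m ∨ v = -(u ^ m)) → ∃ z : K, z ≠ 0 ∧ (((A' : K) + (B' : K) * α) / (n' : K) = ((u : NumberField.RingOfIntegers K) : K) * z ^ 3 ∨ ((A' : K) + (B' : K) * α) / (n' : K) = ((u⁻¹ : (NumberField.RingOfIntegers K)ˣ) : NumberField.RingOfIntegers K) * z ^ 3)) → (|A| + |B| + n < |A'| + |B'| + n' ∨ (|A| + |B| + n = |A'| + |B'| + n' ∧ (A < A' ∨ (A = A' ∧ (B < B' ∨ (B = B' ∧ n ≤ n'))))))) → (2 : ℝ) / 3 ≤ M.pr id (Computability.encodeNat s) {y | y = Literature.Computability.Complexity.boolPair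 (Literature.Computability.Complexity.boolPair (Computability.encodeNat A.natAbs) (Computability.encodeNat B.natAbs)) (Literature.Computability.Complexity.boolPair (Computability.encodeNat n) [decide (A < 0), decide (B < 0)])}

-- earlier MirrorDominates (stmt-QuantumAdvantage-15380, replaced 2026-08-16T17:00:44Z -> stmt-QuantumAdvantage-15987): retired by None — ∀ t : ℤ → ℕ, (∀ (D : ℤ) (K : Type) [Field K] [NumberField K], Module.finrank ℚ K = 2 → NumberField.discr K = D → t D = Nat.card {c : ClassGroup (NumberField.RingOfIntegers K) // c ^ 3 = 1}) → (∀ d : ℕ, (((-(d:ℤ)) % 4 = 1 ∧ Squarefree (-(d:ℤ)) ∧ (-(d:ℤ)) ≠ 1) ∨ (4 ∣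
-- earlier MirrorDominates (stmt-QuantumAdvantage-15717, replaced 2026-08-16T15:35:12Z -> stmt-QuantumAdvantage-15380): retired by None — (∀ d : ℕ, (((-(d:ℤ)) % 4 = 1 ∧ Squarefree (-(d:ℤ)) ∧ (-(d:ℤ)) ≠ 1) ∨ (4 ∣ (-(d:ℤ)) ∧ ((-(d:ℤ)) / 4 % 4 = 2 ∨ (-(d:ℤ)) / 4 % 4 = 3) ∧ Squarefree ((-(d:ℤ)) / 4))) → d ≠ 3 → (let d₀ : ℕ := (if 3 ∣ d then (if 4 ∣ d then d / 12 else d / 3) else (if 4 ∣ d then 3 * (d / 4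
/-- item stmt-QuantumAdvantage-15987 · support · rank 9 · open · by planner
sources: Scholz1932, Washington1997, BhargavaVarma2016, BogdanovTrevisan2006, Literature.NumberTheory.QuadraticFields.ScholzHecke_unitCubeCriterion
[support] DOMINATION BY ARITHSTATLADDER'S HYPOTHESIS (recombination made literal; CONE-REPAIRED rev
1: the antecedents are the decls UnitCubeCriterion, MirrorRankRare, AvgFaceBeyondPrior of route
ArithStatLadder VERBATIM except that the 3-torsion count enters as a BINDER `t : ℤ → ℕ` with the
IST3 hypothesis `∀ D K, finrank ℚ K = 2 → discr K = D → t D = #Cl(K)[3]` — the exact binder shape of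
ArithStatLadder's DigitRung/EndJuntaRung — instead of the constant `quadFieldThreeTorsion`, whose
file drags 32 unproved named facts (Gross–Zagier, Kolyvagin, modular parametrisation, Voronin …)
into the import cone; the instance `t := quadFieldThreeTorsion` via `quadFieldThreeTorsion_spec` is
the old verbatim statement, bridge `fun h => h _ quadFieldThreeTorsion_spec` kernel-checked in the
planner's Bridge.lean): ∀ t, IST3 t → UnitCubeCriterion[t] → MirrorRankRare[t] → AvgFaceBeyondPrior
→ ThirdNotBPPR (re-pointed 2026-08-16 to the repaired target; with z ≠ 0 the 3-adic step below is
exactly right: α* = η^{±1} z³, z ≠ 0, has the image of η^{±1} in K_𝔓^×/cubes). Proof (t only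
mediates between the two arithmetic antecedents): suppose THIRD ∈ BPP; by prefix search (poly many
amplified queries) a B -/
@[route_item "route-QuantumAdvantage-RegulatorThird"]
def MirrorDominates : Prop :=
  ∀ t : ℤ → ℕ, (∀ (D : ℤ) (K : Type) [Field K] [NumberField K], Module.finrank ℚ K = 2 → NumberField.discr K = D → t D = Nat.card {c : ClassGroup (NumberField.RingOfIntegers K) // c ^ 3 = 1}) → (∀ d : ℕ, (((-(d:ℤ)) % 4 = 1 ∧ Squarefree (-(d:ℤ)) ∧ (-(d:ℤ)) ≠ 1) ∨ (4 ∣ (-(d:ℤ)) ∧ ((-(d:ℤ)) / 4 % 4 = 2 ∨ (-(d:ℤ)) / 4 % 4 = 3) ∧ Squarefree ((-(d:ℤ)) / 4))) → d ≠ 3 → (let d₀ : ℕ := (if 3 ∣ d then (if 4 ∣ d then d / 12 else d / 3) else (if 4 ∣ d then 3 * (d / 4) else 3 * d)); let U : Prop := (∃ a b : ℕ, (0 < b ∧ ((a:ℤ) ^ 2 - (d₀:ℤ) * (b:ℤ) ^ 2 = 4 ∨ (a:ℤ) ^ 2 - (d₀:ℤ) * (b:ℤ) ^ 2 = -4) ∧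 ∀ a' b' : ℕ, 0 < b' → ((a':ℤ) ^ 2 - (d₀:ℤ) * (b':ℤ) ^ 2 = 4 ∨ (a':ℤ) ^ 2 - (d₀:ℤ) * (b':ℤ) ^ 2 = -4) → a ≤ a') ∧ ((⟨(a:ℤ), (b:ℤ)⟩ : Zsqrtd (d₀:ℤ)) ^ 8).re % 9 = 4 ∧ (3 ∣ d → (9:ℤ) ∣ ((⟨(a:ℤ), (b:ℤ)⟩ : Zsqrtd (d₀:ℤ)) ^ 8).im) ∧ (¬ 3 ∣ d → (3:ℤ) ∣ ((⟨(a:ℤ), (b:ℤ)⟩ : Zsqrtd (d₀:ℤ)) ^ 8).im)); (U → 3 ∣ Literature.NumberTheory.QuadraticFields.BinaryQuadraticForm.classNumber (-(d:ℤ))) ∧ (t (if 3 ∣ d then ((d / 3 : ℕ) : ℤ) else 3 * (d : ℤ)) = 1 → 3 ∣ Literature.NumberTheory.QuadraticFields.BinaryQuadraticForm.classNumber (-(d:ℤ)) → U))) → (∀ ε : ℝ, 0 < ε → ∀ᶠ n : ℕ in Filter.atTop, (((((Finset.Ico (2 ^ (n - 1)) (2 ^ n)).filter (fun d : ℕ =>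 (((-(d:ℤ)) % 4 = 1 ∧ Squarefree (-(d:ℤ)) ∧ (-(d:ℤ)) ≠ 1) ∨ (4 ∣ (-(d:ℤ)) ∧ ((-(d:ℤ)) / 4 % 4 = 2 ∨ (-(d:ℤ)) / 4 % 4 = 3) ∧ Squarefree ((-(d:ℤ)) / 4))))).filter (fun d : ℕ => t (if 3 ∣ d then ((d / 3 : ℕ) : ℤ) else 3 * (d : ℤ)) ≠ 1)).card : ℝ)) ≤ (1 / 6 + ε) * ((((Finset.Ico (2 ^ (n - 1)) (2 ^ n)).filter (fun d : ℕ => (((-(d:ℤ)) % 4 = 1 ∧ Squarefree (-(d:ℤ)) ∧ (-(d:ℤ)) ≠ 1) ∨ (4 ∣ (-(d:ℤ)) ∧ ((-(d:ℤ)) / 4 % 4 = 2 ∨ (-(d:ℤ)) / 4 % 4 = 3) ∧ Squarefree ((-(d:ℤ)) / 4)))))).card : ℝ)) → ((⟨Computability.encodingNatBool.toLanguage {d : ℕ | (((-(d:ℤ)) % 4 = 1 ∧ Squarefree (-(d:ℤ)) ∧ (-(d:ℤ)) ≠ 1) ∨ (4 ∣ (-(d:ℤ)) ∧ ((-(d:ℤ))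 / 4 % 4 = 2 ∨ (-(d:ℤ)) / 4 % 4 = 3) ∧ Squarefree ((-(d:ℤ)) / 4))) ∧ 3 ∣ Literature.NumberTheory.QuadraticFields.BinaryQuadraticForm.classNumber (-(d:ℤ))}, (fun n : ℕ => if h : (((Finset.Ico (2 ^ (n - 1)) (2 ^ n)).filter (fun d : ℕ => (((-(d:ℤ)) % 4 = 1 ∧ Squarefree (-(d:ℤ)) ∧ (-(d:ℤ)) ≠ 1) ∨ (4 ∣ (-(d:ℤ)) ∧ ((-(d:ℤ)) / 4 % 4 = 2 ∨ (-(d:ℤ)) / 4 % 4 = 3) ∧ Squarefree ((-(d:ℤ)) / 4)))))).Nonempty then (PMF.uniformOfFinset ((Finset.Ico (2 ^ (n - 1)) (2 ^ n)).filter (fun d : ℕ => (((-(d:ℤ)) % 4 = 1 ∧ Squarefree (-(d:ℤ)) ∧ (-(d:ℤ)) ≠ 1) ∨ (4 ∣ (-(d:ℤ)) ∧ ((-(d:ℤ)) / 4 % 4 = 2 ∨ (-(d:ℤ)) / 4 % 4 = 3) ∧ Squarefree ((-(d:ℤ)) / 4))))) h).map Computability.encodeNat else PMF.pure [])⟩ :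 Literature.Computability.MetaComplexity.DistProblem) ∉ Literature.Computability.MetaComplexity.HeurDeltaBPP (fun _ => (1 : ℝ) / 3)) → ThirdNotBPPR

-- earlier Assembly (stmt-QuantumAdvantage-15719, replaced 2026-08-16T17:00:44Z -> stmt-QuantumAdvantage-15988): retired by None — OneThirdRep → OneThirdFP → ThirdMemBQPOfFP → ThirdNotBPP → QuantumAdvantage
/-- item stmt-QuantumAdvantage-15988 · assembly · rank 1 · closed · proved by Summit.QuantumAdvantage.QuantumAdvantage.Theorems.RegulatorThird.Assembly_proof @ 27fc3325a297 (prover) · by planner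
sources: BernsteinVazirani1997, Hallgren2007
[assembly] OneThirdRep -> OneThirdFP -> ThirdMemBQPOfFP -> ThirdNotBPPR -> QuantumAdvantage (one
line of logic on the existential summit; proof term `fun h1 h2 h3 h4 => <_, h3 h1 h2, h4>`
re-checked in the repair planner's Sketch.lean 2026-08-16 after the z ≠ 0 repair; ThirdNotBPPR
replaces the refuted ThirdNotBPP). -/
@[route_item "route-QuantumAdvantage-RegulatorThird"]
def Assembly : Prop :=
  OneThirdRep → OneThirdFP → ThirdMemBQPOfFP → ThirdNotBPPR → QuantumAdvantage

-- `Assembly` holds: proved by `Summit.QuantumAdvantage.QuantumAdvantage.Theorems.RegulatorThird.Assembly_proof` @ 27fc3325a297 (its module imports this route file, so no `_holds` link can be stated here).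

-- records of items no longer active in this route (dropped / restated):
-- earlier ThirdNotBPP (stmt-QuantumAdvantage-15712, replaced 2026-08-16T17:00:44Z -> stmt-QuantumAdvantage-15981): refuted by Summit.QuantumAdvantage.QuantumAdvantage.Theorems.RegulatorThirdThirdNotBPP_refuted @ b65922813997 — {x : List Bool | ∃ (D n : ℕ) (w : List Bool) (A B : ℤ), x = Literature.Computability.Complexity.boolPair (Computability.encodeNat D) w ∧ ¬ IsSquare D ∧ 1 < D ∧ ((∀ s f : ℕ, D 

/-! D-0027 §2.1 — DECIDING THEOREM (planner-authored via `route open/edit --closes-file`; by planner-rfix-QuantumAdvantage-RegulatorThird-2084f307-0 2026-08-16T17:00:44Z):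
its hypotheses are this route's items and its conclusion the sub-problem Statement (glue_lint), and it elaborates with this file. -/

@[closes "route-QuantumAdvantage-RegulatorThird"] theorem closes (h₁ : OneThirdRep) (h₂ : OneThirdFP) (h₃ : ThirdMemBQPOfFP) (h₄ : ThirdNotBPPR) : _root_.QuantumAdvantage :=
  ⟨_, h₃ h₁ h₂, h₄⟩

end Summit.QuantumAdvantage.QuantumAdvantage.Theses.RegulatorThird
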